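import Literature.Probability.Percolation.ZdFiveArmUniqueness
import HarnessLib

/-!
# KSZ's uniqueness of the landed five-arm vertex with EDGE-disjoint right arms (bond `ℤ²`)

Topic `Literature/Probability/Percolation`; PROOFS ONLY (one event definition, no named fact).
Companion of `ZdFiveArmUniqueness.lean` (`zdFiveArmKSZ`, `zdFiveArmKSZ_unique`,
`sum_real_zdFiveArmKSZ_le_one`), which renders KSZ's landed five-arm event `F(w, n)` for bond
percolation on `ℤ²` with the two open arms to the right side pairwise VERTEX-disjoint off the
centre.  The tree's five-arm event `zdFiveArmClusters` (`ZdFourArmFromFiveArm.lean`), however, only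
asks its third open arm to be EDGE-disjoint from the other two ("three open arms, two of which may
touch"), and so do the arms produced from it by Kesten's separation theorem; to serve the point
upper bound of that event (`ZdFiveArmPointBoundOfSeparationE.lean`) this file proves that KSZ's
uniqueness argument survives for edge-disjoint right arms PROVIDED the centre has a closed incident
edge (at most three open edges): two edge-disjoint open paths passing through such a vertex would
need four distinct open edges at it.  In the application the centre is the origin of the hub of
`ZdFiveArmPointBoundOfSeparation.lean`, which has exactly three open edges.

H. Kesten, V. Sidoravicius, Y. Zhang, EJP 3 (1998), proof of Lemma 5, (3.10)–(3.11): "`F(w, n)` can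
occur for at most one `w ∈ S(n)` and consequently `Σ_{w ∈ S(n/2)} P{w is occupied and F(w, n)} ≤ 1`";
P. Nolin, EJP 13 (2008), §5.2, proof of Thm. 24 [arXiv 0711.4948: Thm. 23 (iii), p. 17]: "only one
arm can 'go through' `r₃ ∪ r₅`: the arm `r'₁ ∪ {w}` from `w` to `I₁` has to contain `v`, and so does
`r'₂ ∪ {w}`. Since `r'₁ ∩ r'₂ = ∅`, we get finally `v = w`."  Here "only one arm can go through" is
literally the degree count at a vertex with a closed edge.

## Contents

* `zdFiveArmKSZ3 M N v` (DEFINITION of the event): as `zdFiveArmKSZ M N v` (three open walks from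
  `v` inside `R = [0, M] × [0, N]`, one to the left side, two to the right side; one face walk of the
  dual rectangle from the top face row to the bottom face row crossing closed edges except between
  faces around `v`), but with the two right walks EDGE-disjoint (no other disjointness), the centre
  off the right side (`v₀ + 1 ≤ M`) and some lattice edge at `v` closed;
* `ZdFiveArmKSZ3.exists_adj_edges_of_mem_support` — an interior vertex of a path carries two
  distinct edges of the path; `ZdFiveArmKSZ3.false_of_four_open` — four distinct open edges and a
  closed edge at one vertex of `ℤ²` are impossible;
* `zdFiveArmKSZ3_unique` — **the event occurs for at most one vertex**;
  `pairwise_disjoint_zdFiveArmKSZ3`, `determinedBy_zdFiveArmKSZ3`, `measurableSet_zdFiveArmKSZ3`,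
  `sum_real_zdFiveArmKSZ3_le_one` — **`Σ_{v ∈ V} μ(zdFiveArmKSZ3 M N v) ≤ 1`** for every probability
  measure `μ`.

## References

* H. Kesten, V. Sidoravicius, Y. Zhang, EJP 3 (1998), paper 10, proof of Lemma 5, (3.10)–(3.11)
  [KestenSidoraviciusZhang1998].
* P. Nolin, EJP 13 (2008) 1562–1623, §5.2, proof of Thm. 24 (arXiv 0711.4948: Thm. 23 (iii), p. 17)
  [Nolin2008].
* D. Chelkak, H. Duminil-Copin, C. Hongler, EJP 21 (2016), paper 5, §5.2, proof of Cor. 1.5 ("the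
  events `A_x` are disjoint"; bond `ℤ²`, arms "mutually edge-avoiding") [ChelkakDuminilCopinHongler2016].

Tree: `zdFiveArmKSZ`, `cornerFaces`, `ZdFiveArmKSZ.mem_support_of_dual` (the discrete Jordan engine),
`ZdFiveArmKSZ.not_mem_support_dropUntil` (`ZdFiveArmUniqueness.lean`), `nbrs`, `mem_nbrs_of_adj`,
`sepEdge`, `ZdDual.sep_cases`, `DeterminedBy`.  Mathlib: `SimpleGraph.Walk.bypass`,
`takeUntil`/`dropUntil`, `Finset.eq_of_subset_of_card_le`, `measureReal_biUnion_finset`.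
-/

noncomputable section

open Set MeasureTheory SimpleGraph

namespace Literature.Probability.Percolation

open LatticeModels

/-! ### KSZ's landed five-arm event with edge-disjoint right arms -/

/-- **KSZ's event `{w occupied} ∩ F(w, n)` in the rectangle `R = [0, M] × [0, N]`, bond-`ℤ²` form
with EDGE-disjoint right arms** (KSZ 1998, (3.10); Nolin 2008, proof of Thm. 24, `A_v`; Chelkak–
Duminil-Copin–Hongler 2016, §5.2, "mutually edge-avoiding" arms): the centre `v` is not on the right
side (`v₀ + 1 ≤ M`) and has a CLOSED incident lattice edge; there are three OPEN lattice walks from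
`v` inside `R`, the first to the left side `{x₀ = 0}`, the other two to the right side `{x₀ = M}` and
with no edge in common; and a walk of faces of the dual rectangle `[0, M-1] × [-1, N]` from the top
face row to the bottom face row whose steps cross CLOSED primal edges, except possibly for steps
between two faces around `v`. [cite: KestenSidoraviciusZhang1998, proof of Lemma 5, (3.10)] [cite: Nolin2008, §5.2, proof of Thm. 24 (arXiv 0711.4948: p. 16, the event A_v)] -/
def zdFiveArmKSZ3 (M N : ℕ) (v : Site 2) : Set (BondConfig (Site 2)) :=
  {ω | v 0 + 1 ≤ (M : ℤ) ∧ (∃ u : Site 2, (zdGraph 2).Adj v u ∧ s(v, u) ∉ ω) ∧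
    ∃ (l r r' : Site 2) (P₁ : (zdGraph 2).Walk v l) (P₃ : (zdGraph 2).Walk v r)
      (P₄ : (zdGraph 2).Walk v r'),
    l 0 = 0 ∧ r 0 = M ∧ r' 0 = M ∧
    (∀ z ∈ P₁.support, (0 : ℤ) ≤ z 0 ∧ z 0 ≤ M ∧ (0 : ℤ) ≤ z 1 ∧ z 1 ≤ N) ∧
    (∀ z ∈ P₃.support, (0 : ℤ) ≤ z 0 ∧ z 0 ≤ M ∧ (0 : ℤ) ≤ z 1 ∧ z 1 ≤ N) ∧
    (∀ z ∈ P₄.support, (0 : ℤ) ≤ z 0 ∧ z 0 ≤ M ∧ (0 : ℤ) ≤ z 1 ∧ z 1 ≤ N) ∧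
    (∀ e ∈ P₁.edges, e ∈ ω) ∧ (∀ e ∈ P₃.edges, e ∈ ω) ∧ (∀ e ∈ P₄.edges, e ∈ ω) ∧
    (∀ e ∈ P₃.edges, e ∉ P₄.edges) ∧
    ∃ (t s : Site 2) (Q : (zdGraph 2).Walk t s), t 1 = N ∧ s 1 = -1 ∧
      (∀ z ∈ Q.support, (0 : ℤ) ≤ z 0 ∧ z 0 + 1 ≤ M ∧ (-1 : ℤ) ≤ z 1 ∧ z 1 ≤ N) ∧
      ∀ d ∈ Q.darts, sepEdge d.fst d.snd ∉ ω ∨ (d.fst ∈ cornerFaces v ∧ d.snd ∈ cornerFaces v)}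

/-! ### Two combinatorial lemmas -/

/-- **An interior vertex of a path carries two distinct edges of the path**: if `x` lies on the path
`P : a → b` and is neither endpoint, there are `y ≠ z` with `{y, x}` and `{x, z}` edges of `P`.
[folklore] -/
theorem ZdFiveArmKSZ3.exists_adj_edges_of_mem_support {V : Type*} [DecidableEq V] {G : SimpleGraph V}
    {a b x : V} (P : G.Walk a b) (hP : P.IsPath) (hx : x ∈ P.support) (hxa : x ≠ a) (hxb : x ≠ b) :
    ∃ y z : V, y ≠ z ∧ s(x, y) ∈ P.edges ∧ s(x, z) ∈ P.edges := by
  obtain ⟨z, hz, q₂, hq₂⟩ := Walk.exists_eq_cons_of_ne hxb (P.dropUntil x hx)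
  obtain ⟨y, hy, q₁, hq₁⟩ := Walk.exists_eq_cons_of_ne hxa (P.takeUntil x hx).reverse
  refine ⟨y, z, fun hyz => ?_, ?_, ?_⟩
  · -- `y` lies on the first piece, `z` on the tail of the second: impossible on a path
    have hnd := hP.support_nodup
    rw [← P.take_spec hx, Walk.support_append] at hnd
    have hdisj := List.disjoint_of_nodup_append hnd
    have hy' : y ∈ (P.takeUntil x hx).support := by
      rw [← List.mem_reverse, ← Walk.support_reverse, hq₁, Walk.support_cons]
      exact List.mem_cons_of_mem _ q₁.start_mem_support
    have hz' : z ∈ (P.dropUntil x hx).support.tail := by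
      rw [hq₂, Walk.support_cons, List.tail_cons]
      exact q₂.start_mem_support
    exact hdisj hy' (hyz ▸ hz')
  · refine P.edges_takeUntil_subset_edges hx ?_
    rw [← List.mem_reverse, ← Walk.edges_reverse, hq₁, Walk.edges_cons]
    exact List.mem_cons_self
  · refine P.edges_dropUntil_subset_edges hx ?_
    rw [hq₂, Walk.edges_cons]
    exact List.mem_cons_self

/-- **Four distinct open edges and a closed edge at one vertex of `ℤ²` are impossible** (a vertex of
`ℤ²` has four incident edges). [folklore] -/
theorem ZdFiveArmKSZ3.false_of_four_open {ω : BondConfig (Site 2)} {x y₁ y₂ y₃ y₄ u : Site 2}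
    (h₁ : (zdGraph 2).Adj x y₁) (h₂ : (zdGraph 2).Adj x y₂) (h₃ : (zdGraph 2).Adj x y₃)
    (h₄ : (zdGraph 2).Adj x y₄) (hu : (zdGraph 2).Adj x u)
    (h₁₂ : y₁ ≠ y₂) (h₁₃ : y₁ ≠ y₃) (h₁₄ : y₁ ≠ y₄) (h₂₃ : y₂ ≠ y₃) (h₂₄ : y₂ ≠ y₄) (h₃₄ : y₃ ≠ y₄)
    (ho₁ : s(x, y₁) ∈ ω) (ho₂ : s(x, y₂) ∈ ω) (ho₃ : s(x, y₃) ∈ ω) (ho₄ : s(x, y₄) ∈ ω)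
    (hc : s(x, u) ∉ ω) : False := by
  classical
  set S : Finset (Site 2) := {y₁, y₂, y₃, y₄} with hS
  have hsub : S ⊆ nbrs x := by
    intro w hw
    simp only [hS, Finset.mem_insert, Finset.mem_singleton] at hw
    rcases hw with rfl | rfl | rfl | rfl
    exacts [mem_nbrs_of_adj h₁, mem_nbrs_of_adj h₂, mem_nbrs_of_adj h₃, mem_nbrs_of_adj h₄]
  have hcard : 4 ≤ S.card := by
    rw [hS, Finset.card_insert_of_notMem (by simp [h₁₂, h₁₃, h₁₄]),
      Finset.card_insert_of_notMem (by simp [h₂₃, h₂₄]), Finset.card_insert_of_notMem (by simp [h₃₄]),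
      Finset.card_singleton]
  have hle : (nbrs x).card ≤ S.card := le_trans (by unfold nbrs; exact Finset.card_le_four) hcard
  have heq : S = nbrs x := Finset.eq_of_subset_of_card_le hsub hle
  have hu' : u ∈ S := heq ▸ mem_nbrs_of_adj hu
  simp only [hS, Finset.mem_insert, Finset.mem_singleton] at hu'
  rcases hu' with rfl | rfl | rfl | rfl
  exacts [hc ho₁, hc ho₂, hc ho₃, hc ho₄]

/-- **Two edge-disjoint open paths from a common start cannot both pass through a vertex `x` with a
closed incident edge** (unless `x` is the start or an end): the two paths would use four distinct
open edges at `x`. [folklore] -/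
theorem ZdFiveArmKSZ3.false_of_mem_support_of_mem_support {ω : BondConfig (Site 2)}
    {w x r r' u : Site 2}
    (P : (zdGraph 2).Walk w r) (P' : (zdGraph 2).Walk w r') (hP : P.IsPath) (hP' : P'.IsPath)
    (hPo : ∀ e ∈ P.edges, e ∈ ω) (hP'o : ∀ e ∈ P'.edges, e ∈ ω) (hdj : ∀ e ∈ P.edges, e ∉ P'.edges)
    (hx : x ∈ P.support) (hx' : x ∈ P'.support) (hxw : x ≠ w) (hxr : x ≠ r) (hxr' : x ≠ r')
    (hu : (zdGraph 2).Adj x u) (hc : s(x, u) ∉ ω) : False := by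
  classical
  obtain ⟨y₁, y₂, h₁₂, e₁, e₂⟩ := ZdFiveArmKSZ3.exists_adj_edges_of_mem_support P hP hx hxw hxr
  obtain ⟨y₃, y₄, h₃₄, e₃, e₄⟩ := ZdFiveArmKSZ3.exists_adj_edges_of_mem_support P' hP' hx' hxw hxr'
  have ne : ∀ {y y' : Site 2}, s(x, y) ∈ P.edges → s(x, y') ∈ P'.edges → y ≠ y' := by
    intro y y' hy hy' hyy'
    subst hyy'
    exact hdj _ hy hy'
  exact ZdFiveArmKSZ3.false_of_four_open (P.adj_of_mem_edges e₁) (P.adj_of_mem_edges e₂)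
    (P'.adj_of_mem_edges e₃) (P'.adj_of_mem_edges e₄) hu h₁₂ (ne e₁ e₃) (ne e₁ e₄) (ne e₂ e₃) (ne e₂ e₄)
    h₃₄ (hPo _ e₁) (hPo _ e₂) (hP'o _ e₃) (hP'o _ e₄) hc

/-! ### Uniqueness -/

/-- **KSZ / Nolin uniqueness with edge-disjoint right arms: the event occurs for at most one
vertex.**  If `zdFiveArmKSZ3 M N v` and `zdFiveArmKSZ3 M N w` both hold in `ω` then `v = w`.  Proof (Nolin 2008, p. 17, with the degree count for "only one arm can
go through"): make all open walks paths (`bypass`; edge-disjointness is inherited).  (1) The open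
walks `r₁ v r₃` and `r₁ v r₄` of `v` both contain `w` (`ZdFiveArmKSZ.mem_support_of_dual` with the
dual walk of `w`); if `w ∉ r₁` then `w` is an interior vertex of the two edge-disjoint open paths
`r₃`, `r₄` (it is off the right side), which would use four open edges at `w` — but `w` has a closed
edge.  So `w ∈ r₁`.  (2) The open walks `(r₁ from w to the left side) w r'₃` and `… w r'₄` both
contain `v` (dual walk of `v`); the piece of `r₁` after `w` avoids `v`, so `v` is an interior vertex
of the edge-disjoint open paths `r'₃`, `r'₄`: four open edges at `v`, contradiction.
[cite: Nolin2008, §5.2, proof of Thm. 24 (arXiv 0711.4948: Thm. 23 (iii), p. 17)] [cite: KestenSidoraviciusZhang1998, proof of Lemma 5, (3.10)-(3.11)] -/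
theorem zdFiveArmKSZ3_unique {M N : ℕ} {ω : BondConfig (Site 2)}
    {v w : Site 2} (hv : ω ∈ zdFiveArmKSZ3 M N v) (hw : ω ∈ zdFiveArmKSZ3 M N w) : v = w := by
  classical
  by_contra hne
  obtain ⟨hvM, ⟨uv, huv, hcv⟩, l, r, r', P₁, P₃, P₄, hl, hr, hr', hs₁, hs₃, hs₄, he₁, he₃, he₄, h₃₄, t, s,
    Q, ht, hs, hQs, hQd⟩ := hv
  obtain ⟨hwM, ⟨uw, huw, hcw⟩, l', q, q', P₁', P₃', P₄', -, hq, hq', -, hs₃', hs₄', -, he₃', he₄', h₃₄',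
    t', s', Q', ht', hs', hQs', hQd'⟩ := hw
  -- make the open walks paths
  set P₁b := P₁.bypass with hP₁b
  have hbS : ∀ z ∈ P₁b.support, z ∈ P₁.support := fun z hz => P₁.support_bypass_subset_support hz
  have hbE : ∀ e ∈ P₁b.edges, e ∈ P₁.edges := fun e he => P₁.edges_bypass_subset_edges he
  -- step (1): `w` lies on `r₁ v r₃` and on `r₁ v r₄`
  have step1 : ∀ {x : Site 2} (P : (zdGraph 2).Walk v x), x 0 = M →
      (∀ z ∈ P.support, (0 : ℤ) ≤ z 0 ∧ z 0 ≤ M ∧ (0 : ℤ) ≤ z 1 ∧ z 1 ≤ N) →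
      (∀ e ∈ P.edges, e ∈ ω) → w ∈ P₁b.support ∨ w ∈ P.support := by
    intro x P hx hPs hPe
    have hmem := ZdFiveArmKSZ.mem_support_of_dual (w := w) (P₁b.reverse.append P) ?_ hl hx ?_ Q'
      hQs' ht' hs' hQd'
    · rwa [Walk.mem_support_append_iff, Walk.support_reverse, List.mem_reverse] at hmem
    · intro z hz
      rw [Walk.mem_support_append_iff, Walk.support_reverse, List.mem_reverse] at hz
      rcases hz with hz | hz
      · exact hs₁ z (hbS z hz)
      · exact hPs z hz
    · intro e he
      rw [Walk.edges_append, List.mem_append, Walk.edges_reverse, List.mem_reverse] at he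
      rcases he with he | he
      · exact he₁ e (hbE e he)
      · exact hPe e he
  have hw₁ : w ∈ P₁b.support := by
    rcases step1 P₃.bypass hr (fun z hz => hs₃ z (P₃.support_bypass_subset_support hz))
      (fun e he => he₃ e (P₃.edges_bypass_subset_edges he)) with h | h3
    · exact h
    rcases step1 P₄.bypass hr' (fun z hz => hs₄ z (P₄.support_bypass_subset_support hz))
      (fun e he => he₄ e (P₄.edges_bypass_subset_edges he)) with h | h4
    · exact h
    -- `w` is an interior vertex of the two edge-disjoint open paths `r₃`, `r₄`
    exfalso
    refine ZdFiveArmKSZ3.false_of_mem_support_of_mem_support P₃.bypass P₄.bypass P₃.bypass_isPath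
      P₄.bypass_isPath (fun e he => he₃ e (P₃.edges_bypass_subset_edges he))
      (fun e he => he₄ e (P₄.edges_bypass_subset_edges he))
      (fun e he he' => h₃₄ e (P₃.edges_bypass_subset_edges he) (P₄.edges_bypass_subset_edges he')) h3 h4
      (Ne.symm hne) (fun h => ?_) (fun h => ?_) huw hcw
    · rw [h] at hwM; omega
    · rw [h] at hwM; omega
  -- step (2): the piece of `r₁` beyond `w` avoids `v`
  set S := P₁b.dropUntil w hw₁ with hS
  have hvS : v ∉ S.support := ZdFiveArmKSZ.not_mem_support_dropUntil P₁.bypass_isPath hw₁ hne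
  have hSs : ∀ z ∈ S.support, z ∈ P₁.support := fun z hz =>
    hbS z (P₁b.support_dropUntil_subset_support hw₁ hz)
  have hSe : ∀ e ∈ S.edges, e ∈ P₁.edges := fun e he =>
    hbE e (P₁b.edges_dropUntil_subset_edges hw₁ he)
  have step2 : ∀ {x : Site 2} (P : (zdGraph 2).Walk w x), x 0 = M →
      (∀ z ∈ P.support, (0 : ℤ) ≤ z 0 ∧ z 0 ≤ M ∧ (0 : ℤ) ≤ z 1 ∧ z 1 ≤ N) →
      (∀ e ∈ P.edges, e ∈ ω) → v ∈ P.support := by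
    intro x P hx hPs hPe
    have hmem := ZdFiveArmKSZ.mem_support_of_dual (w := v) (S.reverse.append P) ?_ hl hx ?_ Q
      hQs ht hs hQd
    · rw [Walk.mem_support_append_iff, Walk.support_reverse, List.mem_reverse] at hmem
      exact hmem.resolve_left hvS
    · intro z hz
      rw [Walk.mem_support_append_iff, Walk.support_reverse, List.mem_reverse] at hz
      rcases hz with hz | hz
      · exact hs₁ z (hSs z hz)
      · exact hPs z hz
    · intro e he
      rw [Walk.edges_append, List.mem_append, Walk.edges_reverse, List.mem_reverse] at he
      rcases he with he | he
      · exact he₁ e (hSe e he)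
      · exact hPe e he
  have h3 := step2 P₃'.bypass hq (fun z hz => hs₃' z (P₃'.support_bypass_subset_support hz))
    (fun e he => he₃' e (P₃'.edges_bypass_subset_edges he))
  have h4 := step2 P₄'.bypass hq' (fun z hz => hs₄' z (P₄'.support_bypass_subset_support hz))
    (fun e he => he₄' e (P₄'.edges_bypass_subset_edges he))
  refine ZdFiveArmKSZ3.false_of_mem_support_of_mem_support P₃'.bypass P₄'.bypass P₃'.bypass_isPath
    P₄'.bypass_isPath (fun e he => he₃' e (P₃'.edges_bypass_subset_edges he))
    (fun e he => he₄' e (P₄'.edges_bypass_subset_edges he))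
    (fun e he he' => h₃₄' e (P₃'.edges_bypass_subset_edges he) (P₄'.edges_bypass_subset_edges he')) h3 h4
    hne (fun h => ?_) (fun h => ?_) huv hcv
  · rw [h] at hvM; omega
  · rw [h] at hvM; omega

/-- The events `zdFiveArmKSZ3 M N v`, `v` ranging over the vertices, are pairwise disjoint.
[cite: Nolin2008, §5.2, proof of Thm. 24 (arXiv 0711.4948: p. 17)] -/
theorem pairwise_disjoint_zdFiveArmKSZ3 (M N : ℕ) {v w : Site 2} (hvw : v ≠ w) :
    Disjoint (zdFiveArmKSZ3 M N v) (zdFiveArmKSZ3 M N w) :=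
  Set.disjoint_left.2 fun _ hv hw => hvw (zdFiveArmKSZ3_unique hv hw)

/-! ### Measurability and the sum over the centres -/

/-- The pairs of sites of the enlarged rectangle `[-1, M+1] × [-1, N+1]`: the coordinates read by
`zdFiveArmKSZ3 M N v` (edges of the open walks, edges crossed by the dual walk, and the closed edge
at the centre, which may stick out of `R` by one unit). [folklore] -/
def ZdFiveArmKSZ3.readPairs (M N : ℕ) : Finset (Sym2 (Site 2)) :=
  (Finset.Icc ![(-1 : ℤ), -1] ![(M : ℤ) + 1, (N : ℤ) + 1]).sym2

/-- Membership in the enlarged rectangle, in coordinates. [folklore] -/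
theorem ZdFiveArmKSZ3.mem_Icc_iff {M N : ℕ} {x : Site 2} :
    x ∈ Finset.Icc ![(-1 : ℤ), -1] ![(M : ℤ) + 1, (N : ℤ) + 1] ↔
      -1 ≤ x 0 ∧ x 0 ≤ (M : ℤ) + 1 ∧ -1 ≤ x 1 ∧ x 1 ≤ (N : ℤ) + 1 := by
  simp only [Finset.mem_Icc, Pi.le_def, Fin.forall_fin_two, Matrix.cons_val_zero, Matrix.cons_val_one]
  tauto

/-- The edge crossed by a step of a face walk of the dual rectangle is a read pair. [folklore] -/
theorem ZdFiveArmKSZ3.sepEdge_mem_readPairs {M N : ℕ} {z z' : Site 2} (h : (zdGraph 2).Adj z z')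
    (hz : (0 : ℤ) ≤ z 0 ∧ z 0 + 1 ≤ M ∧ (-1 : ℤ) ≤ z 1 ∧ z 1 ≤ N)
    (hz' : (0 : ℤ) ≤ z' 0 ∧ z' 0 + 1 ≤ M ∧ (-1 : ℤ) ≤ z' 1 ∧ z' 1 ≤ N) :
    sepEdge z z' ∈ ZdFiveArmKSZ3.readPairs M N := by
  rw [ZdFiveArmKSZ3.readPairs, sepEdge, Finset.mk_mem_sym2_iff, ZdFiveArmKSZ3.mem_Icc_iff,
    ZdFiveArmKSZ3.mem_Icc_iff]
  rcases ZdDual.sep_cases h with ⟨h0, h1, hlo0, hlo1, hhi0, hhi1⟩ | ⟨h0, h1, hlo0, hlo1, hhi0, hhi1⟩ |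
      ⟨h1, h0, hlo0, hlo1, hhi0, hhi1⟩ | ⟨h1, h0, hlo0, hlo1, hhi0, hhi1⟩
  all_goals
    rw [hlo0, hlo1, hhi0, hhi1]
    omega

/-- An edge of a lattice walk inside `R` is a read pair. [folklore] -/
theorem ZdFiveArmKSZ3.edge_mem_readPairs {M N : ℕ} {a b : Site 2} (P : (zdGraph 2).Walk a b)
    (hP : ∀ z ∈ P.support, (0 : ℤ) ≤ z 0 ∧ z 0 ≤ M ∧ (0 : ℤ) ≤ z 1 ∧ z 1 ≤ N) {e : Sym2 (Site 2)}
    (he : e ∈ P.edges) : e ∈ ZdFiveArmKSZ3.readPairs M N := by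
  rw [Walk.edges, List.mem_map] at he
  obtain ⟨d, hd, rfl⟩ := he
  have h1 := hP _ (P.dart_fst_mem_support_of_mem_darts hd)
  have h2 := hP _ (P.dart_snd_mem_support_of_mem_darts hd)
  rw [ZdFiveArmKSZ3.readPairs, Dart.edge, Finset.mk_mem_sym2_iff, ZdFiveArmKSZ3.mem_Icc_iff,
    ZdFiveArmKSZ3.mem_Icc_iff]
  omega

/-- A lattice edge at a vertex of `R` is a read pair. [folklore] -/
theorem ZdFiveArmKSZ3.mk_mem_readPairs_of_adj {M N : ℕ} {v u : Site 2} (h : (zdGraph 2).Adj v u)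
    (hv : (0 : ℤ) ≤ v 0 ∧ v 0 ≤ M ∧ (0 : ℤ) ≤ v 1 ∧ v 1 ≤ N) :
    s(v, u) ∈ ZdFiveArmKSZ3.readPairs M N := by
  rw [ZdFiveArmKSZ3.readPairs, Finset.mk_mem_sym2_iff, ZdFiveArmKSZ3.mem_Icc_iff, ZdFiveArmKSZ3.mem_Icc_iff]
  rw [zdGraph_two_adj_iff] at h
  omega

/-- **`zdFiveArmKSZ3 M N v` depends only on the read pairs.** [folklore] -/
theorem determinedBy_zdFiveArmKSZ3 (M N : ℕ) (v : Site 2) :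
    DeterminedBy (zdFiveArmKSZ3 M N v) ↑(ZdFiveArmKSZ3.readPairs M N) := by
  set F := ZdFiveArmKSZ3.readPairs M N with hF
  suffices key : ∀ ω ω' : BondConfig (Site 2), ω ∩ ↑F = ω' ∩ ↑F →
      ω ∈ zdFiveArmKSZ3 M N v → ω' ∈ zdFiveArmKSZ3 M N v by
    rw [determinedBy_iff]
    exact fun ω ω' h => ⟨key ω ω' h, key ω' ω h.symm⟩
  rintro ω ω' h ⟨hvM, ⟨u, hu, hcu⟩, l, r, r', P₁, P₃, P₄, hl, hr, hr', hs₁, hs₃, hs₄, he₁, he₃, he₄, h₃₄,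
    t, s, Q, ht, hs, hQs, hQd⟩
  have agree : ∀ e ∈ F, e ∈ ω ↔ e ∈ ω' := fun e he => by
    constructor
    · intro heω; exact ((Set.ext_iff.1 h e).1 ⟨heω, he⟩).1
    · intro heω; exact ((Set.ext_iff.1 h e).2 ⟨heω, he⟩).1
  have hv := hs₁ v P₁.start_mem_support
  refine ⟨hvM, ⟨u, hu, fun h' => hcu ((agree _ (ZdFiveArmKSZ3.mk_mem_readPairs_of_adj hu hv)).2 h')⟩,
    l, r, r', P₁, P₃, P₄, hl, hr, hr', hs₁, hs₃, hs₄,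
    fun e he => (agree e (ZdFiveArmKSZ3.edge_mem_readPairs P₁ hs₁ he)).1 (he₁ e he),
    fun e he => (agree e (ZdFiveArmKSZ3.edge_mem_readPairs P₃ hs₃ he)).1 (he₃ e he),
    fun e he => (agree e (ZdFiveArmKSZ3.edge_mem_readPairs P₄ hs₄ he)).1 (he₄ e he),
    h₃₄, t, s, Q, ht, hs, hQs, fun d hd => ?_⟩
  rcases hQd d hd with hcl | hc
  · refine Or.inl fun he' => hcl ((agree _ ?_).2 he')
    exact ZdFiveArmKSZ3.sepEdge_mem_readPairs d.adj (hQs _ (Q.dart_fst_mem_support_of_mem_darts hd))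
      (hQs _ (Q.dart_snd_mem_support_of_mem_darts hd))
  · exact Or.inr hc

/-- The event is measurable. [folklore] -/
theorem measurableSet_zdFiveArmKSZ3 (M N : ℕ) (v : Site 2) : MeasurableSet (zdFiveArmKSZ3 M N v) :=
  (determinedBy_zdFiveArmKSZ3 M N v).measurableSet_of_finset

/-- **`Σ_v μ(A_v) ≤ 1`, bond `ℤ²`, edge-disjoint right arms** (KSZ 1998, (3.11); Nolin 2008, proof
of Thm. 24: "`1 ≥ P_{1/2}(∪_v A_v) = Σ_v P_{1/2}(A_v)`"): for every probability measure `μ` on bond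
configurations and every finite set `V` of vertices, `Σ_{v ∈ V} μ(zdFiveArmKSZ3 M N v) ≤ 1` — the
events are measurable and pairwise disjoint. [cite: KestenSidoraviciusZhang1998, proof of Lemma 5, (3.11)] [cite: Nolin2008, §5.2, proof of Thm. 24 (arXiv 0711.4948: p. 17, first display)] -/
theorem sum_real_zdFiveArmKSZ3_le_one (μ : Measure (BondConfig (Site 2))) [IsProbabilityMeasure μ]
    (M N : ℕ) (V : Finset (Site 2)) :
    ∑ v ∈ V, μ.real (zdFiveArmKSZ3 M N v) ≤ 1 := by
  rw [← measureReal_biUnion_finset (fun v _ w _ hvw => pairwise_disjoint_zdFiveArmKSZ3 M N hvw)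
    (fun v _ => measurableSet_zdFiveArmKSZ3 M N v)]
  exact measureReal_le_one

end Literature.Probability.Percolation

end
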